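import Literature.NumberTheory.CubicFields.LocalDensityOdd
import HarnessLib

/-!
# BST Lemma 13 at `p = 2`: `#{f ∈ V(ℤ/16ℤ) : Disc f fundamental at 2} = 9 · 16³`, so `μ(𝒱₂) = 9/16 = (1 − 2⁻²)²`

`Proofs`-style file (theorems only). Topic `Literature/NumberTheory/CubicFields`; continues
`LocalDensityCount.lean` (`card_multipleRoot_eq_mul`) and `LocalDensityOdd.lean` (bookkeeping:
`natCard_box`, `natCard_split`, `natCard_congr_prop`).

Bhargava–Shankar–Tsimerman 2013, Lemma 13: `μ(𝒱_p) = (p² − 1)²/p⁴`, here at `p = 2`, for `𝒱₂` in the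
description used by the tree's sieve (`ThreeTorsionSumFirstOrderSieve.lean`; Bhargava–Varma §3):
`Disc f` is fundamental at `2`, i.e. `Disc ≡ 1 (mod 4)` or `Disc ≡ 8, 12 (mod 16)` (`IsFundAt 2`,
`LocalFundamental.lean`) — a condition on `f mod 16`, rendered here as `Disc f ∈ fundResidues` for
`f ∈ V(ℤ/16ℤ)`. The count follows the printed mechanism (proof of Lemmas 11–12): by Stickelberger
(`Disc = (bc − ad)² + 4(…)`) an odd discriminant is `≡ 1 (mod 4)`, so the `6 · 8⁴` forms that are
squarefree mod `2` all count; a form `≡ 0 (mod 2)` has `16 ∣ Disc`; and a form with a multiple root mod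
`2`, moved to `a ≡ b ≡ 0 (mod 2)`, has `Disc ≡ 4(βc + αd)² + 8αc³ (mod 16)` (`a = 2α`, `b = 2β`), which is
`8` or `12 (mod 16)` exactly when `α` and `c` are odd: `4 · 8 · 8 · 16 = 4096` forms, times `p + 1 = 3`.
* `fundResidues = {1, 5, 9, 13, 8, 12} ⊆ ℤ/16`, `natCard_fibre_map … = 8`, `natCard_map_comp` (fibres of
  `V(ℤ/16) → V(ℤ/2)` have `8⁴` elements);
* `disc_mem_stickelberger` (`Disc mod 16 ∈ {0,1,4,5,8,9,12,13}`), `disc_two_mul` (the identity on the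
  fibre), `mem_fundResidues_iff_of_even` (fundamental iff `a ≡ 2 (mod 4)` and `c` odd);
* `natCard_sqfree_mod_two = 6 · 8⁴`, `natCard_fibre_fund = 4096`, `not_mem_fundResidues_of_map_eq_zero`;
* **`natCard_disc_mem_fundResidues`**: `#{f ∈ V(ℤ/16ℤ) : Disc f ∈ fundResidues} = 36864 = 9 · 16³`, and
  `density_disc_mem_fundResidues`: the density is `9/16 = (1 − 1/2²)²`.

## References

* M. Bhargava, A. Shankar, J. Tsimerman, *On the Davenport–Heilbronn theorems and second order
  terms*, Invent. Math. 193 (2013) 439–499 = arXiv:1005.0672, Lemmas 11–13 [BhargavaShankarTsimerman2012].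
* H. Davenport, H. Heilbronn, *On the density of discriminants of cubic fields. II*, Proc. Roy.
  Soc. London A 322 (1971) 405–420, §4 [DavenportHeilbronn1971].
-/

namespace Literature.NumberTheory.CubicFields

namespace BinaryCubic

open Finset

/-- `2 ∣ 16`. [folklore] -/
theorem two_dvd_sixteen : 2 ∣ 16 := by norm_num

/-- **The fundamental residues mod `16`**: `Disc ≡ 1 (mod 4)` or `Disc ≡ 8, 12 (mod 16)` (`IsFundAt 2`).
[cite: BhargavaShankarTsimerman2012, §8.2 (𝒱_p) with Lemma 13; the residues are those of LocalFundamental.IsFundAt at p = 2] -/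
def fundResidues : Finset (ZMod 16) := {1, 5, 9, 13, 8, 12}

/-! ### Fibres of `ℤ/16 → ℤ/2` -/

/-- Each fibre of `ℤ/16ℤ → ℤ/2ℤ` has `8` elements. [folklore] -/
theorem natCard_fibre_castHom_two (y : ZMod 2) :
    Nat.card {x : ZMod 16 // ZMod.castHom two_dvd_sixteen (ZMod 2) x = y} = 8 := by
  rw [Nat.card_eq_fintype_card, Fintype.card_subtype]
  revert y
  decide

/-- The even residues mod `16`: `8` of them. [folklore] -/
theorem natCard_castHom_two_eq_zero : Nat.card {x : ZMod 16 // ZMod.castHom two_dvd_sixteen (ZMod 2) x = 0} = 8 :=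
  natCard_fibre_castHom_two 0

/-- The odd residues mod `16`: `8` of them. [folklore] -/
theorem natCard_castHom_two_ne_zero : Nat.card {x : ZMod 16 // ¬ ZMod.castHom two_dvd_sixteen (ZMod 2) x = 0} = 8 := by
  rw [natCard_congr_prop (Q := fun x : ZMod 16 => ZMod.castHom two_dvd_sixteen (ZMod 2) x = 1) fun x => ?_]
  · exact natCard_fibre_castHom_two 1
  · generalize ZMod.castHom two_dvd_sixteen (ZMod 2) x = y
    revert y
    decide

/-- The residues `≡ 2 (mod 4)` mod `16`: `4` of them. [folklore] -/
theorem natCard_mem_twoModFour : Nat.card {x : ZMod 16 // x ∈ ({2, 6, 10, 14} : Finset (ZMod 16))} = 4 := by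
  rw [Nat.card_eq_fintype_card, Fintype.card_subtype]
  decide

/-- `#{x ∈ ℤ/16 : True} = 16`. [folklore] -/
theorem natCard_true_zmod_sixteen : Nat.card {_x : ZMod 16 // True} = 16 := by
  rw [Nat.card_congr (Equiv.subtypeUnivEquiv fun _ => trivial), Nat.card_zmod]

/-- **Fibres of `V(A) → V(B)`**: if every fibre of `φ : A → B` has `k` elements, then the forms over
`A` whose reduction satisfies `P` number `k⁴ · #{g ∈ V(B) : P g}`. [folklore] -/
theorem natCard_map_comp {A B : Type*} [CommRing A] [CommRing B] [Finite A] [Finite B] (φ : A →+* B) (k : ℕ)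
    (hk : ∀ y : B, Nat.card {x : A // φ x = y} = k) (P : BinaryCubic B → Prop) :
    Nat.card {f : BinaryCubic A // P (f.map φ)} = Nat.card {g : BinaryCubic B // P g} * k ^ 4 := by
  classical
  have := Fintype.ofFinite A
  have := Fintype.ofFinite B
  have hfib : ∀ g : BinaryCubic B, Nat.card {f : BinaryCubic A // f.map φ = g} = k ^ 4 := by
    intro g
    rw [natCard_congr_prop (Q := fun f : BinaryCubic A => φ f.a = g.a ∧ φ f.b = g.b ∧ φ f.c = g.c ∧ φ f.d = g.d)
      (fun f => BinaryCubic.ext_iff), natCard_box (fun x => φ x = g.a) (fun x => φ x = g.b) (fun x => φ x = g.c)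
      (fun x => φ x = g.d), hk, hk, hk, hk]
    ring
  rw [← Nat.card_congr (Equiv.sigmaSubtypeFiberEquivSubtype (fun f : BinaryCubic A => f.map φ) (p := fun f => P (f.map φ))
      (q := P) fun _ => Iff.rfl), Nat.card_sigma, Finset.sum_congr rfl fun g _ => hfib g.1, sum_const, smul_eq_mul,
    card_univ, ← Nat.card_eq_fintype_card]

/-! ### The discriminant mod `16` -/

/-- **Stickelberger mod `16`**: `Disc = (bc − ad)² + 4(5abcd − ac³ − b³d − 7a²d²)`, so over `ℤ/16ℤ` the
discriminant is one of `0, 1, 4, 5, 8, 9, 12, 13` (never `≡ 2, 3 (mod 4)`). [folklore] -/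
theorem disc_mem_stickelberger (f : BinaryCubic (ZMod 16)) : f.disc ∈ ({0, 1, 4, 5, 8, 9, 12, 13} : Finset (ZMod 16)) := by
  have h : f.disc = (f.b * f.c - f.a * f.d) ^ 2 + 4 * (5 * f.a * f.b * f.c * f.d - f.a * f.c ^ 3 - f.b ^ 3 * f.d - 7 * f.a ^ 2 * f.d ^ 2) := by
    rw [disc_eq]; ring
  rw [h]
  generalize f.b * f.c - f.a * f.d = x
  generalize 5 * f.a * f.b * f.c * f.d - f.a * f.c ^ 3 - f.b ^ 3 * f.d - 7 * f.a ^ 2 * f.d ^ 2 = y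
  revert x y
  decide

/-- An odd discriminant mod `16` is a fundamental residue (`≡ 1 (mod 4)`). [folklore] -/
theorem mem_fundResidues_of_odd {f : BinaryCubic (ZMod 16)} (h : ZMod.castHom two_dvd_sixteen (ZMod 2) f.disc ≠ 0) :
    f.disc ∈ fundResidues := by
  have hs := disc_mem_stickelberger f
  revert h hs
  generalize f.disc = D
  revert D
  decide

/-- An even residue mod `16` is twice something. [folklore] -/
theorem exists_eq_two_mul {x : ZMod 16} (h : ZMod.castHom two_dvd_sixteen (ZMod 2) x = 0) : ∃ y : ZMod 16, x = 2 * y := by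
  revert h x
  decide

/-- **The discriminant on the fibre `a ≡ b ≡ 0 (mod 2)`**: `Disc(2α, 2β, c, d) = 4(βc + αd)² + 8αc³` in
`ℤ/16ℤ` (the remaining terms are `16·(4αβcd − αc³ − 2β³d − 7α²d²)`). [cite: BhargavaShankarTsimerman2012, proof of Lemma 12 (the normal form a ≡ b ≡ 0)] -/
theorem disc_two_mul (α β c d : ZMod 16) :
    (⟨2 * α, 2 * β, c, d⟩ : BinaryCubic (ZMod 16)).disc = 4 * (β * c + α * d) ^ 2 + 8 * (α * c ^ 3) := by
  have h16 : (16 : ZMod 16) = 0 := by decide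
  rw [disc_eq]
  linear_combination (4 * α * β * c * d - α * c ^ 3 - 2 * β ^ 3 * d - 7 * α ^ 2 * d ^ 2) * h16

/-- `4x² + 8y` is a fundamental residue iff `y` is odd. [folklore] -/
theorem four_sq_add_eight_mem_iff (x y : ZMod 16) :
    4 * x ^ 2 + 8 * y ∈ fundResidues ↔ ZMod.castHom two_dvd_sixteen (ZMod 2) y ≠ 0 := by
  revert x y
  decide

/-- `2α ≡ 2 (mod 4)` iff `α` is odd. [folklore] -/
theorem two_mul_mem_iff (α : ZMod 16) :
    2 * α ∈ ({2, 6, 10, 14} : Finset (ZMod 16)) ↔ ZMod.castHom two_dvd_sixteen (ZMod 2) α ≠ 0 := by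
  revert α
  decide

/-- A residue `≡ 2 (mod 4)` is even. [folklore] -/
theorem castHom_eq_zero_of_mem {a : ZMod 16} (h : a ∈ ({2, 6, 10, 14} : Finset (ZMod 16))) :
    ZMod.castHom two_dvd_sixteen (ZMod 2) a = 0 := by
  revert h a
  decide

/-- **Fundamental on the fibre.** For `a, b` even and `(c, d) ≢ (0, 0) (mod 2)`: `Disc f` is a
fundamental residue mod `16` iff `a ≡ 2 (mod 4)` and `c` is odd. [cite: BhargavaShankarTsimerman2012, proof of Lemma 12 (proportions read off the normal form)] -/
theorem mem_fundResidues_iff_of_even {f : BinaryCubic (ZMod 16)} (ha : ZMod.castHom two_dvd_sixteen (ZMod 2) f.a = 0)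
    (hb : ZMod.castHom two_dvd_sixteen (ZMod 2) f.b = 0) :
    f.disc ∈ fundResidues ↔ (f.a ∈ ({2, 6, 10, 14} : Finset (ZMod 16)) ∧ ZMod.castHom two_dvd_sixteen (ZMod 2) f.c ≠ 0) := by
  obtain ⟨α, hα⟩ := exists_eq_two_mul ha
  obtain ⟨β, hβ⟩ := exists_eq_two_mul hb
  obtain ⟨a, b, c, d⟩ := f
  simp only at hα hβ ⊢
  subst hα hβ
  rw [disc_two_mul, four_sq_add_eight_mem_iff, two_mul_mem_iff, map_mul, map_pow, mul_ne_zero_iff]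
  constructor
  · rintro ⟨h1, h2⟩
    exact ⟨h1, fun h => h2 (by rw [h, zero_pow three_ne_zero])⟩
  · rintro ⟨h1, h2⟩
    exact ⟨h1, pow_ne_zero 3 h2⟩

/-- A form `≡ 0 (mod 2)` has `16 ∣ Disc`, hence is not fundamental at `2`. [folklore] -/
theorem not_mem_fundResidues_of_map_eq_zero {f : BinaryCubic (ZMod 16)}
    (h : f.map (ZMod.castHom two_dvd_sixteen (ZMod 2)) = 0) : f.disc ∉ fundResidues := by
  rw [map_eq_zero_iff] at h
  obtain ⟨α, hα⟩ := exists_eq_two_mul h.1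
  obtain ⟨β, hβ⟩ := exists_eq_two_mul h.2.1
  obtain ⟨γ, hγ⟩ := exists_eq_two_mul h.2.2.1
  obtain ⟨δ, hδ⟩ := exists_eq_two_mul h.2.2.2
  have hf : f = (2 : ZMod 16) • (⟨α, β, γ, δ⟩ : BinaryCubic (ZMod 16)) := by
    obtain ⟨a, b, c, d⟩ := f
    simp only at hα hβ hγ hδ
    subst hα hβ hγ hδ
    ext <;> simp
  rw [hf, disc_smul, show ((2 : ZMod 16) ^ 4) = 0 by decide, zero_mul]
  decide

/-! ### The counts -/

/-- **Squarefree mod `2`**: `#{f ∈ V(ℤ/16ℤ) : Disc f odd} = 6 · 8⁴` (the `6` forms over `𝔽₂` of nonzero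
discriminant, `T₂(111) ∪ T₂(12) ∪ T₂(3)`, times the fibre). [cite: BhargavaShankarTsimerman2012, Lemma 11 (μ(T_p(111)) + μ(T_p(12)) + μ(T_p(3)) at p = 2: (1+3+2)/16)] -/
theorem natCard_sqfree_mod_two :
    Nat.card {f : BinaryCubic (ZMod 16) // (f.map (ZMod.castHom two_dvd_sixteen (ZMod 2))).disc ≠ 0} = 6 * 8 ^ 4 := by
  rw [natCard_map_comp (ZMod.castHom two_dvd_sixteen (ZMod 2)) 8 natCard_fibre_castHom_two (fun g => g.disc ≠ 0)]
  congr 1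
  rw [Nat.card_eq_fintype_card, Fintype.card_subtype, show (6 : ℕ) = (univ.filter fun v : ZMod 2 × ZMod 2 × ZMod 2 × ZMod 2 =>
      (⟨v.1, v.2.1, v.2.2.1, v.2.2.2⟩ : BinaryCubic (ZMod 2)).disc ≠ 0).card by simp only [disc_eq]; decide]
  refine Finset.card_bij (fun f _ => equivProd f) (fun f hf => ?_) (fun f _ g _ h => equivProd.injective h)
    (fun v hv => ⟨equivProd.symm v, ?_, equivProd.apply_symm_apply v⟩)
  · obtain ⟨a, b, c, d⟩ := f
    simpa using hf
  · obtain ⟨a, b, c, d⟩ := v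
    simpa [equivProd] using hv

/-- **The fibre count at `2`**: `#{f mod 16 : f ≢ 0 (mod 2), Disc f fundamental, a ≡ b ≡ 0 (mod 2)} = 4096`
(`a ≡ 2 (mod 4)`: 4 choices; `b` even: 8; `c` odd: 8; `d`: 16). [cite: BhargavaShankarTsimerman2012, proof of Lemma 12 (proportions on the normal form)] -/
theorem natCard_fibre_fund :
    Nat.card {f : BinaryCubic (ZMod 16) // f.map (ZMod.castHom two_dvd_sixteen (ZMod 2)) ≠ 0 ∧ f.disc ∈ fundResidues ∧
      (f.map (ZMod.castHom two_dvd_sixteen (ZMod 2))).a = 0 ∧ (f.map (ZMod.castHom two_dvd_sixteen (ZMod 2))).b = 0} = 4096 := by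
  set π := ZMod.castHom two_dvd_sixteen (ZMod 2) with hπ
  have h : ∀ f : BinaryCubic (ZMod 16), (f.map π ≠ 0 ∧ f.disc ∈ fundResidues ∧ (f.map π).a = 0 ∧ (f.map π).b = 0) ↔
      (f.a ∈ ({2, 6, 10, 14} : Finset (ZMod 16)) ∧ π f.b = 0 ∧ ¬ π f.c = 0 ∧ True) := by
    intro f
    simp only [ne_eq, map_eq_zero_iff, map_a, map_b, and_true]
    constructor
    · rintro ⟨-, hD, ha, hb⟩
      obtain ⟨ha', hc⟩ := (mem_fundResidues_iff_of_even ha hb).mp hD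
      exact ⟨ha', hb, hc⟩
    · rintro ⟨ha, hb, hc⟩
      have ha' := castHom_eq_zero_of_mem ha
      exact ⟨fun h => hc h.2.2.1, (mem_fundResidues_iff_of_even ha' hb).mpr ⟨ha, hc⟩, ha', hb⟩
  rw [natCard_congr_prop h, natCard_box (fun x => x ∈ ({2, 6, 10, 14} : Finset (ZMod 16))) (fun x => π x = 0)
      (fun x => ¬ π x = 0) (fun _ => True),
    natCard_mem_twoModFour, natCard_castHom_two_eq_zero, natCard_castHom_two_ne_zero, natCard_true_zmod_sixteen]

/-- **BST Lemma 13 at `p = 2`, as a count mod `16`**: `#{f ∈ V(ℤ/16ℤ) : Disc f fundamental at 2} = 36864`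
(`= 6·8⁴` squarefree mod `2`, plus `3 · 4096` with a multiple root mod `2`; none `≡ 0 (mod 2)`).
[cite: BhargavaShankarTsimerman2012, Lemma 13 (μ(𝒱_2) = (2²−1)²/2⁴ = 9/16)] -/
theorem natCard_disc_mem_fundResidues : Nat.card {f : BinaryCubic (ZMod 16) // f.disc ∈ fundResidues} = 36864 := by
  set π := ZMod.castHom two_dvd_sixteen (ZMod 2) with hπ
  rw [natCard_split _ (fun f => f.map π = 0)]
  have h0 : ∀ f : BinaryCubic (ZMod 16), (f.disc ∈ fundResidues ∧ f.map π = 0) ↔ False :=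
    fun f => ⟨fun h => not_mem_fundResidues_of_map_eq_zero h.2 h.1, False.elim⟩
  rw [natCard_congr_prop h0, show Nat.card {_f : BinaryCubic (ZMod 16) // False} = 0 by simp, zero_add,
    natCard_split _ (fun f => (f.map π).disc = 0)]
  have h1 : ∀ f : BinaryCubic (ZMod 16), ((f.disc ∈ fundResidues ∧ ¬ f.map π = 0) ∧ (f.map π).disc = 0) ↔
      (f.map π ≠ 0 ∧ (f.map π).disc = 0 ∧ f.disc ∈ fundResidues) :=
    fun f => ⟨fun h => ⟨h.1.2, h.2, h.1.1⟩, fun h => ⟨⟨h.2.2, h.1⟩, h.2.1⟩⟩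
  have h2 : ∀ f : BinaryCubic (ZMod 16), ((f.disc ∈ fundResidues ∧ ¬ f.map π = 0) ∧ ¬ (f.map π).disc = 0) ↔
      (f.map π).disc ≠ 0 := by
    intro f
    refine ⟨fun h => h.2, fun h => ⟨⟨mem_fundResidues_of_odd (by rwa [disc_map] at h), fun h0 => h ?_⟩, h⟩⟩
    rw [h0, disc_zero]
  have hC : ∀ γ : Matrix (Fin 2) (Fin 2) ℤ, γ.det = 1 → ∀ f : BinaryCubic (ZMod 16),
      (f.subst (γ.map (Int.castRingHom (ZMod 16)))).disc ∈ fundResidues ↔ f.disc ∈ fundResidues := fun γ hγ f => by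
    rw [disc_subst_of_det_eq_one f (det_map_eq_one hγ)]
  rw [natCard_congr_prop h1, natCard_congr_prop h2, natCard_sqfree_mod_two,
    card_multipleRoot_eq_mul Nat.prime_two two_dvd_sixteen (fun f => f.disc ∈ fundResidues) hC, natCard_fibre_fund]
  norm_num

/-- **The local density at `2`**: `#{f ∈ V(ℤ/16ℤ) : Disc f fundamental at 2} / 16⁴ = 9/16 = (1 − 1/2²)²`.
[cite: BhargavaShankarTsimerman2012, Lemma 13 (μ(𝒱_2) = 9/16)] -/
theorem density_disc_mem_fundResidues :
    (Nat.card {f : BinaryCubic (ZMod 16) // f.disc ∈ fundResidues} : ℝ) / (16 : ℝ) ^ 4 = (1 - 1 / (2 : ℝ) ^ 2) ^ 2 := by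
  rw [natCard_disc_mem_fundResidues]
  norm_num

end BinaryCubic

end Literature.NumberTheory.CubicFields
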